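import Literature.Analysis.FunctionSpaces.UniformRandomWalkDensityPlane
import Mathlib.MeasureTheory.Integral.IntervalIntegral.Periodic
import Mathlib.MeasureTheory.Function.JacobianOneDim
import Mathlib.Analysis.SpecialFunctions.Trigonometric.Inverse
import HarnessLib

/-!
# Short uniform random walks: the law of the distance after two steps, `p₂(x) = 2/(π√(4 − x²))`

Fourth sibling file of `Literature/Analysis/FunctionSpaces/UniformRandomWalkDensity.lean`, about
the laws `uniformWalkLaw n` of `UniformRandomWalkDensityPlane.lean`. The source treats the case
`n = 2` as known ("The density `p₂` … is elementary", [BorweinEtAl2012, §1]; it is the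
`n = 2` case of Kluyver's (2.1), `p₂(x) = ∫₀^∞ x t J₀(xt) J₀(t)² dt = 2/(π√(4 − x²))` on
`(0, 2)`). Since `J₀(‖ξ‖)²` is not integrable on the plane, the Fourier route of
`UniformRandomWalkDensityInversion.lean` (`n ≥ 5`) does not apply; here the law of `|S₂|` is
computed directly: `S₂ = e^{iΘ₁} + e^{iΘ₂}`, `|S₂| = 2|cos((Θ₂ − Θ₁)/2)|`, the angular average is
shift-invariant (Haar measure on `AddCircle (2π)`), and the substitution `y = 2cos(t/2)` turns
`dt` into `2 dy/√(4 − y²)`.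

* `lintegral_unitStepLaw`, `setLIntegral_Ioc_comp_sub_of_periodic`, `norm_cexp_add_cexp` — tools;
* `lintegral_norm_uniformWalkLaw_two` — `∫ g(‖z‖) dμ₂ = (2π)⁻¹ ∫₀^{2π} g(2|cos(t/2)|) dt`;
* `lintegral_norm_uniformWalkLaw_two_eq` — `= ∫₀² g(x) · 2/(π√(4 − x²)) dx`;
* `map_norm_uniformWalkLaw_two` — **the law of `|S₂|` is `p₂(x) dx`, `p₂(x) = 2/(π√(4 − x²))`
  on `(0, 2)`**;
* `lintegral_norm_conv_unitStepLaw`, `lintegral_norm_uniformWalkLaw_succ` — the weak form of the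
  one-step recursion [BorweinEtAl2012, (4.1)],
  `E g(|S_{n+1}|) = E (2π)⁻¹ ∫₀^{2π} g(√(|S_n|² − 2|S_n| cos α + 1)) dα`.

## References

* [BorweinEtAl2012] J. M. Borwein, A. Straub, J. Wan, W. Zudilin, Densities of short uniform random
  walks, Canad. J. Math. 64 (2012) 961–990 = arXiv:1103.2995, §1–§2 (`p₂`, eq. (2.1)),
  §4 eq. (4.1) (the recursion, after [hughes-rw] = B. D. Hughes, *Random Walks and Random
  Environments* I, 1995).
-/

noncomputable section

open _root_.MeasureTheory _root_.Set _root_.Real _root_.Complex _root_.Filter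
open scoped ENNReal RealInnerProductSpace

namespace Literature.Analysis.FunctionSpaces

/-- Lower integral against the unit-step law: the normalised angular average. [folklore] -/
theorem lintegral_unitStepLaw (g : ℂ → ℝ≥0∞) (hg : Measurable g) :
    ∫⁻ z, g z ∂unitStepLaw =
      ENNReal.ofReal (2 * π)⁻¹ * ∫⁻ θ in Ioc (0 : ℝ) (2 * π), g (cexp (θ * I)) := by
  have hmeas : Measurable fun θ : ℝ => cexp (θ * I) :=
    (Complex.continuous_exp.comp (Complex.continuous_ofReal.mul continuous_const)).measurable
  rw [unitStepLaw, lintegral_smul_measure, lintegral_map hg hmeas, smul_eq_mul]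

/-- Shift invariance of the angular integral of a `2π`-periodic function. [folklore] -/
theorem setLIntegral_Ioc_comp_sub_of_periodic {F : ℝ → ℝ≥0∞} (hF : Function.Periodic F (2 * π))
    (a : ℝ) : ∫⁻ θ in Ioc (0 : ℝ) (2 * π), F (θ - a) = ∫⁻ θ in Ioc (0 : ℝ) (2 * π), F θ := by
  haveI : Fact (0 < 2 * π) := ⟨by positivity⟩
  have hG : Function.Periodic (fun θ => F (θ - a)) (2 * π) := hF.sub_const a
  have h1 := AddCircle.lintegral_preimage (T := 2 * π) 0 hF.lift
  have h2 := AddCircle.lintegral_preimage (T := 2 * π) 0 hG.lift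
  simp only [zero_add, Function.Periodic.lift_coe] at h1 h2
  rw [h1, h2]
  have h3 : ∀ b : AddCircle (2 * π), hG.lift b = hF.lift (b - (a : AddCircle (2 * π))) := by
    intro b
    induction b using QuotientAddGroup.induction_on with
    | H x => rw [Function.Periodic.lift_coe, ← QuotientAddGroup.mk_sub, Function.Periodic.lift_coe]
  simp_rw [h3]
  exact lintegral_sub_right_eq_self _ _

/-- `‖e^{iθ₁} + e^{iθ₂}‖ = 2|cos((θ₂ − θ₁)/2)|`. [folklore] -/
theorem norm_cexp_add_cexp (θ₁ θ₂ : ℝ) :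
    ‖cexp (θ₁ * I) + cexp (θ₂ * I)‖ = 2 * |Real.cos ((θ₂ - θ₁) / 2)| := by
  have h1 : cexp (θ₁ * I) + cexp (θ₂ * I) = cexp (θ₁ * I) * (1 + cexp ((θ₂ - θ₁ : ℝ) * I)) := by
    rw [mul_add, mul_one, ← Complex.exp_add]
    congr 2
    push_cast
    ring
  rw [h1, norm_mul, Complex.norm_exp_ofReal_mul_I, one_mul]
  have h2 : ‖(1 : ℂ) + cexp ((θ₂ - θ₁ : ℝ) * I)‖ ^ 2 = (2 * |Real.cos ((θ₂ - θ₁) / 2)|) ^ 2 := by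
    rw [Complex.sq_norm, Complex.normSq_apply]
    simp only [Complex.add_re, Complex.one_re, Complex.add_im, Complex.one_im,
      Complex.exp_ofReal_mul_I_re, Complex.exp_ofReal_mul_I_im, zero_add]
    rw [mul_pow, sq_abs, Real.cos_sq, show 2 * ((θ₂ - θ₁) / 2) = θ₂ - θ₁ by ring]
    nlinarith [Real.sin_sq_add_cos_sq (θ₂ - θ₁)]
  have h3 : 0 ≤ 2 * |Real.cos ((θ₂ - θ₁) / 2)| := by positivity
  exact (pow_left_inj₀ (norm_nonneg _) h3 two_ne_zero).1 h2

/-- **The law of `|S₂|` against a test function, angular form**: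
`∫ g(‖z‖) dμ₂(z) = (2π)⁻¹ ∫₀^{2π} g(2|cos(t/2)|) dt`. [folklore] -/
theorem lintegral_norm_uniformWalkLaw_two (g : ℝ → ℝ≥0∞) (hg : Measurable g) :
    ∫⁻ z, g ‖z‖ ∂(uniformWalkLaw 2) =
      ENNReal.ofReal (2 * π)⁻¹ * ∫⁻ t in Ioc (0 : ℝ) (2 * π), g (2 * |Real.cos (t / 2)|) := by
  set c : ℝ≥0∞ := ENNReal.ofReal (2 * π)⁻¹ with hc
  set F : ℝ → ℝ≥0∞ := fun t => g (2 * |Real.cos (t / 2)|) with hF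
  have hFper : Function.Periodic F (2 * π) := fun t => by
    simp only [hF]
    rw [show (t + 2 * π) / 2 = t / 2 + π by ring, Real.cos_add_pi, abs_neg]
  have h2 : uniformWalkLaw 2 = unitStepLaw ∗ unitStepLaw := by
    rw [uniformWalkLaw_succ, uniformWalkLaw_succ, uniformWalkLaw_zero, Measure.dirac_zero_conv]
  have hgn : Measurable fun z : ℂ => g ‖z‖ := hg.comp measurable_norm
  rw [h2, Measure.lintegral_conv hgn]
  have hexp : Measurable fun θ : ℝ => cexp (θ * I) :=
    (Complex.continuous_exp.comp (Complex.continuous_ofReal.mul continuous_const)).measurable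
  -- the inner integral is the constant `c * ∫ F`
  have hinner : ∀ x : ℂ, ‖x‖ = 1 → ∀ θ₁ : ℝ, x = cexp (θ₁ * I) →
      ∫⁻ y, g ‖x + y‖ ∂unitStepLaw = c * ∫⁻ t in Ioc (0 : ℝ) (2 * π), F t := by
    intro x _ θ₁ hx
    have hm : Measurable fun y : ℂ => g ‖x + y‖ := hgn.comp (measurable_const_add x)
    rw [lintegral_unitStepLaw (fun y : ℂ => g ‖x + y‖) hm, hx]
    simp_rw [norm_cexp_add_cexp]
    have : (fun θ : ℝ => g (2 * |Real.cos ((θ - θ₁) / 2)|)) = fun θ => F (θ - θ₁) := rfl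
    rw [this, setLIntegral_Ioc_comp_sub_of_periodic hFper]
  have hmeasI : Measurable fun x : ℂ => ∫⁻ y, g ‖x + y‖ ∂unitStepLaw :=
    (hgn.comp measurable_add).lintegral_prod_right'
  rw [lintegral_unitStepLaw _ hmeasI]
  have hI : ∀ θ₁ ∈ Ioc (0 : ℝ) (2 * π), ∫⁻ y, g ‖cexp (θ₁ * I) + y‖ ∂unitStepLaw =
      c * ∫⁻ t in Ioc (0 : ℝ) (2 * π), F t := fun θ₁ _ =>
    hinner _ (Complex.norm_exp_ofReal_mul_I θ₁) θ₁ rfl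
  rw [setLIntegral_congr_fun measurableSet_Ioc hI, setLIntegral_const, Real.volume_Ioc, sub_zero,
    ← hc]
  -- `c * (c * J * 2π) = c * J`
  have hcc : c * ENNReal.ofReal (2 * π) = 1 := by
    rw [hc, ← ENNReal.ofReal_mul (by positivity), inv_mul_cancel₀ (by positivity),
      ENNReal.ofReal_one]
  calc c * (c * (∫⁻ t in Ioc (0 : ℝ) (2 * π), F t) * ENNReal.ofReal (2 * π))
      = (c * ENNReal.ofReal (2 * π)) * (c * ∫⁻ t in Ioc (0 : ℝ) (2 * π), F t) := by ring
    _ = c * ∫⁻ t in Ioc (0 : ℝ) (2 * π), F t := by rw [hcc, one_mul]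

/-- The image of `(0, 2π)` under `t ↦ 2cos(t/2)` is `(−2, 2)`. [folklore] -/
theorem image_two_mul_cos_half :
    (fun t : ℝ => 2 * Real.cos (t / 2)) '' Ioo 0 (2 * π) = Ioo (-2) 2 := by
  ext y
  constructor
  · rintro ⟨t, ht, rfl⟩
    have h0 : 0 < t / 2 := by linarith [ht.1]
    have hπ : t / 2 < π := by linarith [ht.2]
    have h1 : Real.cos (t / 2) < 1 := by
      rw [← Real.cos_zero]
      exact Real.strictAntiOn_cos (by simp [pi_pos.le]) ⟨h0.le, hπ.le⟩ h0
    have h2 : -1 < Real.cos (t / 2) := by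
      rw [← Real.cos_pi]
      exact Real.strictAntiOn_cos ⟨h0.le, hπ.le⟩ (by simp [pi_pos.le]) hπ
    constructor <;> linarith
  · intro hy
    refine ⟨2 * Real.arccos (y / 2), ⟨?_, ?_⟩, ?_⟩
    · have : 0 < Real.arccos (y / 2) := Real.arccos_pos.2 (by linarith [hy.2])
      linarith
    · have : Real.arccos (y / 2) < π := Real.arccos_lt_pi.2 (by linarith [hy.1])
      linarith
    · show 2 * Real.cos (2 * Real.arccos (y / 2) / 2) = y
      rw [show 2 * Real.arccos (y / 2) / 2 = Real.arccos (y / 2) by ring,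
        Real.cos_arccos (by linarith [hy.1]) (by linarith [hy.2])]
      ring

/-- **The substitution `y = 2cos(t/2)`**: for measurable `g`,
`∫_{(0,2π)} g(2|cos(t/2)|) dt = ∫_{(−2,2)} g(|y|) · 2/√(4 − y²) dy`. [folklore] -/
theorem setLIntegral_comp_two_mul_cos_half (g : ℝ → ℝ≥0∞) :
    ∫⁻ t in Ioo (0 : ℝ) (2 * π), g (2 * |Real.cos (t / 2)|) =
      ∫⁻ y in Ioo (-2 : ℝ) 2, g |y| * ENNReal.ofReal (2 / Real.sqrt (4 - y ^ 2)) := by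
  have hderiv : ∀ t ∈ Ioo (0 : ℝ) (2 * π), HasDerivWithinAt (fun t : ℝ => 2 * Real.cos (t / 2))
      (-Real.sin (t / 2)) (Ioo 0 (2 * π)) t := by
    intro t _
    have h := ((Real.hasDerivAt_cos (t / 2)).comp t ((hasDerivAt_id' t).div_const 2)).const_mul 2
    exact (h.congr_deriv (by ring)).hasDerivWithinAt
  have hinj : InjOn (fun t : ℝ => 2 * Real.cos (t / 2)) (Ioo 0 (2 * π)) := by
    intro a ha b hb hab
    have ha' : a / 2 ∈ Icc 0 π := ⟨by linarith [ha.1], by linarith [ha.2]⟩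
    have hb' : b / 2 ∈ Icc 0 π := ⟨by linarith [hb.1], by linarith [hb.2]⟩
    have := Real.strictAntiOn_cos.injOn ha' hb' (by simpa using hab)
    linarith
  have key := lintegral_image_eq_lintegral_abs_deriv_mul measurableSet_Ioo hderiv hinj
    (fun y => g |y| * ENNReal.ofReal (2 / Real.sqrt (4 - y ^ 2)))
  rw [image_two_mul_cos_half] at key
  rw [key]
  refine setLIntegral_congr_fun measurableSet_Ioo fun t ht => ?_
  have hsin : 0 < Real.sin (t / 2) := Real.sin_pos_of_pos_of_lt_pi (by linarith [ht.1])
    (by linarith [ht.2])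
  have hsq : Real.sqrt (4 - (2 * Real.cos (t / 2)) ^ 2) = 2 * Real.sin (t / 2) := by
    rw [show 4 - (2 * Real.cos (t / 2)) ^ 2 = (2 * Real.sin (t / 2)) ^ 2 by
      nlinarith [Real.sin_sq_add_cos_sq (t / 2)]]
    exact Real.sqrt_sq (by positivity)
  rw [abs_neg, abs_of_pos hsin, hsq, abs_mul, abs_of_pos (by norm_num : (0 : ℝ) < 2)]
  rw [show ENNReal.ofReal (Real.sin (t / 2)) * (g (2 * |Real.cos (t / 2)|) *
      ENNReal.ofReal (2 / (2 * Real.sin (t / 2)))) = g (2 * |Real.cos (t / 2)|) *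
      (ENNReal.ofReal (Real.sin (t / 2)) * ENNReal.ofReal (2 / (2 * Real.sin (t / 2)))) by ring,
    ← ENNReal.ofReal_mul hsin.le,
    show Real.sin (t / 2) * (2 / (2 * Real.sin (t / 2))) = 1 by field_simp, ENNReal.ofReal_one,
    mul_one]

/-- Folding `(−2, 2)` onto `(0, 2)` for an even integrand. [folklore] -/
theorem setLIntegral_Ioo_neg_two_two_even (G : ℝ → ℝ≥0∞) (hG : ∀ y, G (-y) = G y) :
    ∫⁻ y in Ioo (-2 : ℝ) 2, G y = 2 * ∫⁻ y in Ioo (0 : ℝ) 2, G y := by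
  have hsplit : Ioo (-2 : ℝ) 2 = Ioc (-2 : ℝ) 0 ∪ Ioo 0 2 := (Ioc_union_Ioo_eq_Ioo (by norm_num)
    (by norm_num)).symm
  rw [hsplit, lintegral_union measurableSet_Ioo
    (Set.disjoint_left.2 fun x hx hx' => (lt_irrefl x (hx.2.trans_lt hx'.1)).elim)]
  have hneg : ∫⁻ y in Ioc (-2 : ℝ) 0, G y = ∫⁻ y in Ioo (0 : ℝ) 2, G y := by
    rw [setLIntegral_congr Ioo_ae_eq_Ioc.symm]
    have himg : (fun y : ℝ => -y) '' Ioo (0 : ℝ) 2 = Ioo (-2) 0 := by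
      ext y; constructor
      · rintro ⟨x, hx, rfl⟩; exact ⟨by linarith [hx.2], by linarith [hx.1]⟩
      · intro hy; exact ⟨-y, ⟨by linarith [hy.2], by linarith [hy.1]⟩, neg_neg y⟩
    have key := lintegral_image_eq_lintegral_abs_deriv_mul measurableSet_Ioo
      (fun y _ => (hasDerivAt_neg y).hasDerivWithinAt) (fun a _ b _ h => neg_injective h) G
      (f := fun y : ℝ => -y) (s := Ioo (0 : ℝ) 2)
    rw [himg] at key
    rw [key]
    refine setLIntegral_congr_fun measurableSet_Ioo fun y _ => ?_
    rw [abs_neg, abs_one, ENNReal.ofReal_one, one_mul, hG]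
  rw [hneg, two_mul]

/-- **The law of the distance after two steps, test-function form**: for measurable `g`,
`∫ g(‖z‖) dμ₂(z) = ∫₀² g(x) · 2/(π√(4 − x²)) dx` — the arcsine-type law of `|S₂| = 2|cos(Θ/2)|`.
[folklore] -/
theorem lintegral_norm_uniformWalkLaw_two_eq (g : ℝ → ℝ≥0∞) (hg : Measurable g) :
    ∫⁻ z, g ‖z‖ ∂(uniformWalkLaw 2) =
      ∫⁻ x in Ioo (0 : ℝ) 2, g x * ENNReal.ofReal (2 / (π * Real.sqrt (4 - x ^ 2))) := by
  rw [lintegral_norm_uniformWalkLaw_two g hg, ← setLIntegral_congr Ioo_ae_eq_Ioc,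
    setLIntegral_comp_two_mul_cos_half, setLIntegral_Ioo_neg_two_two_even _ (fun y => by
      simp only [abs_neg, even_two, Even.neg_pow])]
  rw [← mul_assoc, ← lintegral_const_mul' _ _ (by
    exact ENNReal.mul_ne_top ENNReal.ofReal_ne_top ENNReal.ofNat_ne_top)]
  refine setLIntegral_congr_fun measurableSet_Ioo fun x hx => ?_
  rw [abs_of_pos hx.1, show ENNReal.ofReal (2 * π)⁻¹ * 2 = ENNReal.ofReal ((2 * π)⁻¹ * 2) by
    rw [ENNReal.ofReal_mul (by positivity), ENNReal.ofReal_ofNat]]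
  rw [mul_comm (ENNReal.ofReal _) (g x * _), mul_assoc, ← ENNReal.ofReal_mul (by positivity)]
  congr 2
  field_simp

/-- **The law of `|S₂|`** (Kluyver's `p₂`, the classical two-step case): the distance after two
uniform unit steps has density `p₂(x) = 2/(π√(4 − x²))` on `(0, 2)`.
[cite: BorweinEtAl2012, §1 (p₂ "is elementary")] -/
theorem map_norm_uniformWalkLaw_two :
    (uniformWalkLaw 2).map (fun z : ℂ => ‖z‖) =
      (volume.restrict (Ioo (0 : ℝ) 2)).withDensity
        (fun x => ENNReal.ofReal (2 / (π * Real.sqrt (4 - x ^ 2)))) := by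
  refine Measure.ext_of_lintegral _ fun g hg => ?_
  rw [lintegral_map hg measurable_norm, lintegral_norm_uniformWalkLaw_two_eq g hg,
    lintegral_withDensity_eq_lintegral_mul _ (by fun_prop) hg]
  refine setLIntegral_congr_fun measurableSet_Ioo fun x _ => ?_
  rw [Pi.mul_apply, mul_comm]

/-! ## The one-step recursion (BSWZ (4.1)) in weak form -/

/-- `‖x + e^{iθ}‖² = ‖x‖² + 2‖x‖cos(θ − arg x) + 1` (polar form of `x`). [folklore] -/
theorem norm_add_cexp_mul_I_sq (x : ℂ) (θ : ℝ) :
    ‖x + cexp (θ * I)‖ ^ 2 = ‖x‖ ^ 2 + 2 * ‖x‖ * Real.cos (θ - Complex.arg x) + 1 := by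
  have hx : (‖x‖ : ℂ) * cexp (Complex.arg x * I) = x := Complex.norm_mul_exp_arg_mul_I x
  have h1 : x + cexp (θ * I) =
      cexp (Complex.arg x * I) * ((‖x‖ : ℂ) + cexp ((θ - Complex.arg x : ℝ) * I)) := by
    rw [mul_add, ← Complex.exp_add, mul_comm (cexp _) (‖x‖ : ℂ), hx]
    congr 2
    push_cast
    ring
  rw [h1, norm_mul, Complex.norm_exp_ofReal_mul_I, one_mul, Complex.sq_norm, Complex.normSq_apply]
  simp only [Complex.add_re, Complex.ofReal_re, Complex.add_im, Complex.ofReal_im,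
    Complex.exp_ofReal_mul_I_re, Complex.exp_ofReal_mul_I_im, zero_add]
  nlinarith [Real.sin_sq_add_cos_sq (θ - Complex.arg x)]

/-- `‖x + e^{iθ}‖ = √(‖x‖² − 2‖x‖cos α + 1)` with `α = θ − arg x − π`. [folklore] -/
theorem norm_add_cexp_mul_I (x : ℂ) (θ : ℝ) :
    ‖x + cexp (θ * I)‖ =
      Real.sqrt (‖x‖ ^ 2 - 2 * ‖x‖ * Real.cos (θ - (Complex.arg x + π)) + 1) := by
  rw [show θ - (Complex.arg x + π) = θ - Complex.arg x - π by ring, Real.cos_sub_pi,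
    show ‖x‖ ^ 2 - 2 * ‖x‖ * -Real.cos (θ - Complex.arg x) + 1 =
      ‖x‖ ^ 2 + 2 * ‖x‖ * Real.cos (θ - Complex.arg x) + 1 by ring,
    ← norm_add_cexp_mul_I_sq, Real.sqrt_sq (norm_nonneg _)]

/-- **Adding one uniform unit step, weak form of the recursion [BorweinEtAl2012, (4.1)]**: for
any measure `ν` on the plane and measurable `g ≥ 0`,
`∫ g(‖z‖) d(ν ∗ σ)(z) = ∫ (2π)⁻¹ ∫₀^{2π} g(√(‖x‖² − 2‖x‖cos α + 1)) dα dν(x)` (`σ = unitStepLaw`);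
when `ν` and `ν ∗ σ` have radial densities `2πx φ_{n−1}(x)`, `2πx φ_n(x)` this is the printed
`φ_n(x) = (2π)⁻¹ ∫₀^{2π} φ_{n−1}(√(x² − 2x cos α + 1)) dα`. Proof: convolution, the angular average
against `σ`, and its invariance under the shift by `arg x + π`.
[cite: BorweinEtAl2012, §4 eq. (4.1)] -/
theorem lintegral_norm_conv_unitStepLaw (ν : Measure ℂ) (g : ℝ → ℝ≥0∞) (hg : Measurable g) :
    ∫⁻ z, g ‖z‖ ∂(ν ∗ unitStepLaw) =
      ∫⁻ x, ENNReal.ofReal (2 * π)⁻¹ *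
        (∫⁻ α in Ioc (0 : ℝ) (2 * π), g (Real.sqrt (‖x‖ ^ 2 - 2 * ‖x‖ * Real.cos α + 1))) ∂ν := by
  have hgn : Measurable fun z : ℂ => g ‖z‖ := hg.comp measurable_norm
  rw [Measure.lintegral_conv hgn]
  refine lintegral_congr fun x => ?_
  have hm : Measurable fun y : ℂ => g ‖x + y‖ := hgn.comp (measurable_const_add x)
  rw [lintegral_unitStepLaw (fun y : ℂ => g ‖x + y‖) hm]
  congr 1
  simp_rw [norm_add_cexp_mul_I x]
  set G : ℝ → ℝ≥0∞ := fun α => g (Real.sqrt (‖x‖ ^ 2 - 2 * ‖x‖ * Real.cos α + 1)) with hG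
  have hGper : Function.Periodic G (2 * π) := fun α => by
    simp only [hG, Real.cos_add_two_pi]
  exact setLIntegral_Ioc_comp_sub_of_periodic hGper (Complex.arg x + π)

/-- The recursion for the uniform walk: `E g(|S_{n+1}|) = E (2π)⁻¹∫₀^{2π} g(√(|S_n|² −
2|S_n|cos α + 1)) dα`. [cite: BorweinEtAl2012, §4 eq. (4.1)] -/
theorem lintegral_norm_uniformWalkLaw_succ (n : ℕ) (g : ℝ → ℝ≥0∞) (hg : Measurable g) :
    ∫⁻ z, g ‖z‖ ∂(uniformWalkLaw (n + 1)) =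
      ∫⁻ x, ENNReal.ofReal (2 * π)⁻¹ *
        (∫⁻ α in Ioc (0 : ℝ) (2 * π), g (Real.sqrt (‖x‖ ^ 2 - 2 * ‖x‖ * Real.cos α + 1)))
          ∂(uniformWalkLaw n) := by
  rw [uniformWalkLaw_succ]
  exact lintegral_norm_conv_unitStepLaw _ g hg

end Literature.Analysis.FunctionSpaces

end
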